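import Mathlib.GroupTheory.Schreier
import Mathlib.GroupTheory.FreeGroup.NielsenSchreier
import Literature.GroupTheory.CombinatorialGroupTheory.FreeGroupSubgroupSeparable
import Literature.AnabelianGeometry.SemiGraphs.TemperedAnabelian
import HarnessLib

/-!
# Profinitely closed subgroups: `ι⁻¹(closure ι(D)) = D` from closedness + levelwise separability
# (the group theory behind [IUTchI] Cor. 2.3 (v) «`F̂ ∩ G = F`»; M. Hall / [SemiAnbd] Cor. 1.6 (ii))

Mochizuki, *Inter-universal Teichmüller theory I*, §2, proof of Cor. 2.3 (v), p. 49 l. −9 – p. 50 l. 2: "it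
suffices to verify the following analogue of assertion (v) for a nonabelian finitely generated free discrete
group `G`: for any finitely generated subgroup `F ⊆ G`, if we use the notation `∧` to denote the pro-`Σ̂`
completion, then `F̂ ∩ G = F`.  But … it follows immediately from [SemiAnbd], Corollary 1.6, (ii), that we may
assume without loss of generality that the inclusion `F ⊆ G` admits a splitting … in which case the desired
equality follows immediately" [cite: Mochizuki2012, IUTchI Cor 2.3(v) pp.49-50] (`[claim: Mochizuki2012,
status: disputed]`; nothing of the series is asserted); M. Hall, *Coset representations in free groups*, Trans.
AMS **67** (1949), Thm. 5.1 [cite: Hall1949, Thm. 5.1]; Mochizuki, *Semi-graphs of anabelioids* (2006), §6 p. 69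
(profinite completions) [cite: MochizukiSemiAnbd2006, §6 p.69].

PROOF-ONLY file (abc-iut cell, layer L3, row «DECOMP-PROFINITE» sequel = sub-row (P1) of GAP row G-w5d028-2,
seat abc-iut-w5-d240 gen 6; no definition, no instance, no new named fact).  The ENGINE reducing the
[IUTchI] Cor. 2.3 (v) statement «`Π̂_ℍ ∩ Π^tp_𝔾 = Π^tp_ℍ`» (abc-iut-L5's `cor23v_of_graph` input; for the
tree's decomposition subgroups `D ∈ decompSubgroups c ℍ`: `ι⁻¹(closure ι(D)) = D`) to CLOSEDNESS of `D` plus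
the André-level structure of `π₁^temp`, over the tree's `IsProfiniteCompletion`:

* §1 (pure group theory) `exists_normal_finiteIndex_not_mem_sup_of_isFreeGroup_finiteIndex` /
  `exists_finiteIndex_le_not_mem_of_isFreeGroup_finiteIndex` — **finitely generated subgroups of VIRTUALLY
  FREE groups are separable** (closed in the profinite topology), from the tree's M. Hall separability for
  free groups (`Literature.GroupTheory.CombinatorialGroupTheory.exists_normal_finiteIndex_not_mem_sup`,
  `FreeGroupSubgroupSeparable.lean`) through `IsFreeGroup.toFreeGroup`, Schreier (`Subgroup.fg_of_index_ne_zero`)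
  and the finitely many cosets of `H ⊓ G` in `H`;
* §2 `IsProfiniteCompletion.comap_topologicalClosure_map_eq_of_separable` — separability of `D` by OPEN
  normal finite-index subgroups ⟹ `ι⁻¹(closure ι(D)) = D` (`comap_surjective` of the completion);
  `Subgroup.separable_of_isClosed_of_levels` — `D` CLOSED + a neighbourhood basis of open normal `N` with
  levelwise separability of the image of `D` in `Γ/N` ⟹ that separability (normal cores);
  `…_of_isClosed_of_levels` — the composite;
* §3 `Subgroup.levelSeparable_of_isFreeGroup_finiteIndex` — the levelwise clause at a level `N` with `Γ/N`
  virtually free and the image of `D` finitely generated (§1 pulled back), and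
  **`IsProfiniteCompletion.comap_topologicalClosure_map_eq_of_isClosed_of_virtuallyFree_levels`** — the
  assembly in the exact shape of abc-iut's André towers (`TemperedPiChart.charTower_of_coherent`: every
  neighbourhood of `1` in `π₁^temp(𝒢)` contains an open normal `M` with `π₁^temp(𝒢)/M` virtually free).

The group is called `Γ` (`Π` is a reserved token).  Nothing here takes a side on [IUTchIII] Cor. 3.12.
-/

namespace Literature.AnabelianGeometry.SemiGraphs

open scoped Pointwise
open Topology
open Literature.GroupTheory.CombinatorialGroupTheory (exists_normal_finiteIndex_not_mem_sup fg_map_of_fg)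

universe u v

/-! ### §1 Finitely generated subgroups of virtually free groups are separable (M. Hall + cosets) -/

section VirtuallyFree

variable {Q : Type u} [Group Q]

/-- In a group with a FREE subgroup `G` of finite index, every `y ∉ H ⊓ G` (for `H` finitely generated)
is separated from `H ⊓ G` by a normal subgroup of finite index: `y ∉ (H ⊓ G) N`.  (Inside `G` this is
M. Hall's separability of finitely generated subgroups of free groups, `exists_normal_finiteIndex_not_mem_sup`;
outside `G` the normal core of `G` separates.) [cite: Hall1949, Thm. 5.1] -/
theorem exists_normal_finiteIndex_not_mem_inf_sup (G : Subgroup Q) [IsFreeGroup G] [G.FiniteIndex]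
    (H : Subgroup Q) (hH : H.FG) {y : Q} (hy : y ∉ H ⊓ G) :
    ∃ N : Subgroup Q, N.Normal ∧ N.FiniteIndex ∧ y ∉ (H ⊓ G) ⊔ N := by
  classical
  by_cases hyG : y ∈ G
  · -- `H ⊓ G` as a finitely generated subgroup of the free group `G ≃ F(Generators G)`
    haveI : Group.FG H := (Group.fg_iff_subgroup_fg H).2 hH
    haveI : Group.FG (G.subgroupOf H) := Subgroup.fg_of_index_ne_zero _
    have hfgH : (H.subgroupOf G).FG := by
      rw [← Group.fg_iff_subgroup_fg]
      -- `H.subgroupOf G ≃* G.subgroupOf H` (both are `H ⊓ G`)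
      let e₁ : (H.subgroupOf G) ≃* (H ⊓ G : Subgroup Q) :=
        (Subgroup.inf_subgroupOf_right H G) ▸ Subgroup.subgroupOfEquivOfLe inf_le_right
      let e₂ : (G.subgroupOf H) ≃* (H ⊓ G : Subgroup Q) := by
        rw [← Subgroup.inf_subgroupOf_left]
        exact Subgroup.subgroupOfEquivOfLe inf_le_left
      exact Group.fg_of_surjective (f := e₁.symm.toMonoidHom.comp e₂.toMonoidHom)
        (e₁.symm.surjective.comp e₂.surjective)
    let e := IsFreeGroup.toFreeGroup G
    have hfg' : ((H.subgroupOf G).map e.toMonoidHom).FG := fg_map_of_fg _ hfgH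
    have hy' : e ⟨y, hyG⟩ ∉ (H.subgroupOf G).map e.toMonoidHom := by
      intro h
      obtain ⟨z, hz, hz'⟩ := Subgroup.mem_map.1 h
      have hzy : z = ⟨y, hyG⟩ := e.injective hz'
      subst hzy
      exact hy ⟨hz, hyG⟩
    obtain ⟨P, hPn, hPfi, hyP⟩ := exists_normal_finiteIndex_not_mem_sup _ hfg' hy'
    haveI := hPn
    haveI := hPfi
    -- pull `P` back to `G`, push to `Q`, take the normal core
    let P₀ : Subgroup G := P.comap e.toMonoidHom
    haveI hP₀fi : P₀.FiniteIndex := by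
      constructor
      rw [Subgroup.index_comap_of_surjective _ e.surjective]
      exact hPfi.index_ne_zero
    let P₁ : Subgroup Q := P₀.map G.subtype
    haveI hP₁fi : P₁.FiniteIndex := by
      constructor
      rw [Subgroup.index_map_subtype]
      exact mul_ne_zero hP₀fi.index_ne_zero Subgroup.FiniteIndex.index_ne_zero
    refine ⟨P₁.normalCore, inferInstance, inferInstance, fun hmem => hyP ?_⟩
    -- `y ∈ (H ⊓ G) ⊔ core(P₁) ≤ ((H.subgroupOf G) ⊔ P₀).map G.subtype`
    have hle : (H ⊓ G) ⊔ P₁.normalCore ≤ ((H.subgroupOf G) ⊔ P₀).map G.subtype := by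
      rw [Subgroup.map_sup]
      refine sup_le_sup ?_ ((Subgroup.normalCore_le P₁).trans le_rfl)
      intro x hx
      exact ⟨⟨x, hx.2⟩, hx.1, rfl⟩
    obtain ⟨z, hz, hzy⟩ := Subgroup.mem_map.1 (hle hmem)
    have hz' : z = ⟨y, hyG⟩ := Subtype.ext hzy
    subst hz'
    have : e ⟨y, hyG⟩ ∈ ((H.subgroupOf G) ⊔ P₀).map e.toMonoidHom := Subgroup.mem_map_of_mem _ hz
    rw [Subgroup.map_sup, Subgroup.map_comap_eq_self_of_surjective e.surjective] at this
    exact this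
  · refine ⟨G.normalCore, inferInstance, inferInstance, fun hmem => hyG ?_⟩
    exact (sup_le inf_le_right (Subgroup.normalCore_le G)) hmem

/-- **Finitely generated subgroups of virtually free groups are separable** (closed in the profinite
topology): if `Q` has a free subgroup `G` of finite index, `H ≤ Q` is finitely generated and `g ∉ H`, then
some NORMAL subgroup `N` of finite index has `g ∉ H N` (M. Hall for `G`, assembled over the finitely many
cosets of `H ⊓ G` in `H`). [cite: Hall1949, Thm. 5.1] -/
theorem exists_normal_finiteIndex_not_mem_sup_of_isFreeGroup_finiteIndex (G : Subgroup Q) [IsFreeGroup G]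
    [G.FiniteIndex] (H : Subgroup Q) (hH : H.FG) {g : Q} (hg : g ∉ H) :
    ∃ N : Subgroup Q, N.Normal ∧ N.FiniteIndex ∧ g ∉ H ⊔ N := by
  classical
  -- cosets of `H ⊓ G` in `H`
  let S : Subgroup H := G.subgroupOf H
  haveI : S.FiniteIndex := inferInstance
  haveI : Finite (H ⧸ S) := Subgroup.finite_quotient_of_finiteIndex
  -- for each coset representative `r`, `r⁻¹ g ∉ H ⊓ G`
  have hrep : ∀ t : H ⧸ S, ((t.out : H) : Q)⁻¹ * g ∉ H ⊓ G := by
    intro t hmem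
    apply hg
    have : ((t.out : H) : Q) * (((t.out : H) : Q)⁻¹ * g) ∈ H := H.mul_mem (t.out).2 hmem.1
    simpa using this
  choose N hNn hNfi hNsep using fun t : H ⧸ S =>
    exists_normal_finiteIndex_not_mem_inf_sup G H hH (hrep t)
  haveI : (⨅ t, N t).Normal := Subgroup.normal_iInf_normal hNn
  refine ⟨⨅ t, N t, inferInstance, Subgroup.finiteIndex_iInf hNfi, ?_⟩
  intro hmem
  have hmem' : g ∈ ((H ⊔ ⨅ t, N t : Subgroup Q) : Set Q) := hmem
  rw [Subgroup.mul_normal] at hmem'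
  obtain ⟨h, hh, n, hn, rfl⟩ := hmem'
  -- the coset of `h`
  let t : H ⧸ S := QuotientGroup.mk ⟨h, hh⟩
  have ht : ((t.out : H) : Q)⁻¹ * h ∈ H ⊓ G := by
    have h1 : (t.out : H)⁻¹ * ⟨h, hh⟩ ∈ S := QuotientGroup.eq.1 (QuotientGroup.out_eq' t)
    exact ⟨H.mul_mem (H.inv_mem (t.out).2) hh, h1⟩
  apply hNsep t
  have : ((t.out : H) : Q)⁻¹ * (h * n) = (((t.out : H) : Q)⁻¹ * h) * n := by group
  rw [this]
  exact Subgroup.mul_mem _ (Subgroup.mem_sup_left ht) (Subgroup.mem_sup_right (Subgroup.mem_iInf.1 hn t))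

/-- The subgroup form: a finite-index subgroup containing `H` but not `g`. [cite: Hall1949, Thm. 5.1] -/
theorem exists_finiteIndex_le_not_mem_of_isFreeGroup_finiteIndex (G : Subgroup Q) [IsFreeGroup G]
    [G.FiniteIndex] (H : Subgroup Q) (hH : H.FG) {g : Q} (hg : g ∉ H) :
    ∃ K : Subgroup Q, K.FiniteIndex ∧ H ≤ K ∧ g ∉ K := by
  obtain ⟨N, _, hNfi, hgN⟩ := exists_normal_finiteIndex_not_mem_sup_of_isFreeGroup_finiteIndex G H hH hg
  haveI := hNfi
  exact ⟨H ⊔ N, Subgroup.finiteIndex_of_le le_sup_right, le_sup_left, hgN⟩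

end VirtuallyFree

/-! ### §2 The engine: `ι⁻¹(closure ι(D)) = D` from separability by open normal subgroups of finite index -/

section Engine

variable {Γ : Type u} [Group Γ] [TopologicalSpace Γ] [IsTopologicalGroup Γ]
  {P : Type v} [Group P] [TopologicalSpace P] [IsTopologicalGroup P] {ι : Γ →ₜ* P}

omit [IsTopologicalGroup Γ] in
/-- **Profinitely closed subgroups.**  If every `g ∉ D` is separated from `D` by an OPEN normal subgroup
`U` of finite index (`g ∉ D U`), then `D` is closed for the profinite topology of `Γ`: for any profinite
completion `ι : Γ → Π̂` (`IsProfiniteCompletion`), `ι⁻¹(closure ι(D)) = D` — because `U = ι⁻¹ V` for an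
open normal `V ≤ Π̂` and `ι(g) V` is an open neighbourhood of `ι g`. [cite: MochizukiSemiAnbd2006, §6 p.69] -/
theorem IsProfiniteCompletion.comap_topologicalClosure_map_eq_of_separable (hι : IsProfiniteCompletion ι)
    (D : Subgroup Γ)
    (hsep : ∀ g ∉ D, ∃ U : Subgroup Γ, U.Normal ∧ U.FiniteIndex ∧ IsOpen (U : Set Γ) ∧ g ∉ D ⊔ U) :
    ((D.map ι.toMonoidHom).topologicalClosure).comap ι.toMonoidHom = D := by
  refine le_antisymm ?_ fun d hd => ?_
  · intro g hg
    by_contra hgD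
    obtain ⟨U, hUn, hUfi, hUo, hgU⟩ := hsep g hgD
    haveI := hUn
    obtain ⟨V, hV⟩ := hι.comap_surjective { toSubgroup := U, isOpen' := hUo, isNormal' := hUn } hUfi
    have hmem : ι g ∈ closure ((D.map ι.toMonoidHom : Subgroup P) : Set P) := by
      rw [← Subgroup.topologicalClosure_coe]; exact hg
    -- the open neighbourhood `{p | (ι g)⁻¹ p ∈ V}` of `ι g` meets `ι(D)`
    obtain ⟨p, ⟨hpV, hpD⟩⟩ := mem_closure_iff.1 hmem {p | (ι g)⁻¹ * p ∈ (V : Set P)}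
      (V.isOpen'.preimage (continuous_const.mul continuous_id)) (by simp)
    obtain ⟨d, hd, rfl⟩ := Subgroup.mem_map.1 hpD
    have hgd : g⁻¹ * d ∈ U := by
      change g⁻¹ * d ∈ ({ toSubgroup := U, isOpen' := hUo, isNormal' := hUn } : OpenNormalSubgroup Γ).toSubgroup
      rw [hV]
      change ι.toMonoidHom (g⁻¹ * d) ∈ V.toSubgroup
      rw [map_mul, map_inv]
      exact hpV
    apply hgU
    have : g = d * (g⁻¹ * d)⁻¹ := by group
    rw [this]
    exact Subgroup.mul_mem _ (Subgroup.mem_sup_left hd) (Subgroup.mem_sup_right (U.inv_mem hgd))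
  · exact Subgroup.le_topologicalClosure _ (Subgroup.mem_map_of_mem _ hd)

/-- **Separability from closedness and LEVELWISE separability.**  If `D` is CLOSED and every
neighbourhood of `1` contains an open normal subgroup `N` such that every `g ∉ D N` lies outside some
finite-index subgroup containing `D N` (separability of the image of `D` in the discrete quotient
`Γ/N`), then every `g ∉ D` is separated from `D` by an open normal subgroup of finite index.
[cite: MochizukiSemiAnbd2006, §6 p.69] -/
theorem Subgroup.separable_of_isClosed_of_levels (D : Subgroup Γ) (hD : IsClosed (D : Set Γ))
    (hlev : ∀ W ∈ 𝓝 (1 : Γ), ∃ N : Subgroup Γ, N.Normal ∧ IsOpen (N : Set Γ) ∧ (N : Set Γ) ⊆ W ∧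
      ∀ g ∉ D ⊔ N, ∃ K : Subgroup Γ, K.FiniteIndex ∧ D ⊔ N ≤ K ∧ g ∉ K) :
    ∀ g ∉ D, ∃ U : Subgroup Γ, U.Normal ∧ U.FiniteIndex ∧ IsOpen (U : Set Γ) ∧ g ∉ D ⊔ U := by
  intro g hg
  -- `D` closed and `g ∉ D`: a neighbourhood `W` of `1` with `g W ∩ D = ∅`
  have hW : (fun w => g * w) ⁻¹' (D : Set Γ)ᶜ ∈ 𝓝 (1 : Γ) :=
    ((continuous_const.mul continuous_id : Continuous fun w : Γ => g * w)).continuousAt.preimage_mem_nhds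
      (by simpa using hD.isOpen_compl.mem_nhds hg)
  obtain ⟨N, hNn, hNo, hNW, hK⟩ := hlev _ hW
  haveI := hNn
  have hgN : g ∉ D ⊔ N := by
    intro hmem
    have hmem' : g ∈ ((D ⊔ N : Subgroup Γ) : Set Γ) := hmem
    rw [Subgroup.mul_normal] at hmem'
    obtain ⟨d, hd, n, hn, hdn⟩ := hmem'
    have hn' : g * n⁻¹ ∈ (D : Set Γ) := by
      rw [← hdn]; simpa using hd
    exact hNW (N.inv_mem hn) hn'
  obtain ⟨K, hKfi, hle, hgK⟩ := hK g hgN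
  haveI := hKfi
  refine ⟨K.normalCore, inferInstance, inferInstance, ?_, fun hmem => hgK ?_⟩
  · exact Subgroup.isOpen_mono ((Subgroup.normal_le_normalCore.mpr (le_sup_right.trans hle))) hNo
  · exact (sup_le (le_sup_left.trans hle) (Subgroup.normalCore_le K)) hmem

/-- **Assembly**: `D` closed + levelwise separability ⟹ `ι⁻¹(closure ι(D)) = D` for every profinite
completion `ι`. [cite: MochizukiSemiAnbd2006, §6 p.69] -/
theorem IsProfiniteCompletion.comap_topologicalClosure_map_eq_of_isClosed_of_levels
    (hι : IsProfiniteCompletion ι) (D : Subgroup Γ) (hD : IsClosed (D : Set Γ))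
    (hlev : ∀ W ∈ 𝓝 (1 : Γ), ∃ N : Subgroup Γ, N.Normal ∧ IsOpen (N : Set Γ) ∧ (N : Set Γ) ⊆ W ∧
      ∀ g ∉ D ⊔ N, ∃ K : Subgroup Γ, K.FiniteIndex ∧ D ⊔ N ≤ K ∧ g ∉ K) :
    ((D.map ι.toMonoidHom).topologicalClosure).comap ι.toMonoidHom = D :=
  hι.comap_topologicalClosure_map_eq_of_separable D (Subgroup.separable_of_isClosed_of_levels D hD hlev)

/-! ### §3 Levelwise separability from a VIRTUALLY FREE discrete quotient (André levels) -/

omit [TopologicalSpace Γ] [IsTopologicalGroup Γ] in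
/-- **Levelwise separability at a virtually free level.**  If `N ⊴ Γ` is such that `Γ/N` has a free
subgroup of finite index and the image of `D` in `Γ/N` is finitely generated, then every `g ∉ D N` is
excluded by a finite-index subgroup containing `D N` (§1 in `Γ/N`, pulled back).
[cite: Hall1949, Thm. 5.1] -/
theorem Subgroup.levelSeparable_of_isFreeGroup_finiteIndex (D N : Subgroup Γ) [N.Normal]
    (G : Subgroup (Γ ⧸ N)) [IsFreeGroup G] [G.FiniteIndex] (hfg : (D.map (QuotientGroup.mk' N)).FG) :
    ∀ g ∉ D ⊔ N, ∃ K : Subgroup Γ, K.FiniteIndex ∧ D ⊔ N ≤ K ∧ g ∉ K := by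
  intro g hg
  have hgbar : QuotientGroup.mk' N g ∉ D.map (QuotientGroup.mk' N) := by
    intro h
    obtain ⟨d, hd, hdg⟩ := Subgroup.mem_map.1 h
    obtain ⟨z, hz, hdz⟩ := (QuotientGroup.mk'_eq_mk' N).1 hdg
    apply hg
    rw [← hdz]
    exact Subgroup.mul_mem _ (Subgroup.mem_sup_left hd) (Subgroup.mem_sup_right hz)
  obtain ⟨Kbar, hKfi, hle, hgK⟩ :=
    exists_finiteIndex_le_not_mem_of_isFreeGroup_finiteIndex G _ hfg hgbar
  haveI := hKfi
  refine ⟨Kbar.comap (QuotientGroup.mk' N), ?_, ?_, fun hmem => hgK hmem⟩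
  · constructor
    rw [Subgroup.index_comap_of_surjective _ (QuotientGroup.mk'_surjective N)]
    exact hKfi.index_ne_zero
  · refine sup_le (Subgroup.map_le_iff_le_comap.1 hle) fun n hn => ?_
    rw [Subgroup.mem_comap]
    have h1 : QuotientGroup.mk' N n = 1 := (QuotientGroup.eq_one_iff n).2 hn
    rw [h1]
    exact Kbar.one_mem

/-- **Assembly at ANDRÉ LEVELS** (the shape produced by abc-iut's `TemperedPiChart.charTower_of_coherent`):
`D` closed, every neighbourhood of `1` containing an open normal `M` with `Γ/M` VIRTUALLY FREE, and the
image of `D` in every such quotient finitely generated ⟹ `ι⁻¹(closure ι(D)) = D` for every profinite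
completion `ι`. [cite: MochizukiSemiAnbd2006, §6 p.69] -/
theorem IsProfiniteCompletion.comap_topologicalClosure_map_eq_of_isClosed_of_virtuallyFree_levels
    (hι : IsProfiniteCompletion ι) (D : Subgroup Γ) (hD : IsClosed (D : Set Γ))
    (hlev : ∀ W ∈ 𝓝 (1 : Γ), ∃ M : OpenNormalSubgroup Γ, (M : Set Γ) ⊆ W ∧
      ∃ (G : Subgroup (Γ ⧸ M.toSubgroup)) (_ : IsFreeGroup G), G.FiniteIndex)
    (hfg : ∀ M : OpenNormalSubgroup Γ, (D.map (QuotientGroup.mk' M.toSubgroup)).FG) :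
    ((D.map ι.toMonoidHom).topologicalClosure).comap ι.toMonoidHom = D := by
  refine hι.comap_topologicalClosure_map_eq_of_isClosed_of_levels D hD fun W hW => ?_
  obtain ⟨M, hMW, G, hG, hGfi⟩ := hlev W hW
  haveI : M.toSubgroup.Normal := M.isNormal'
  haveI := hG
  haveI := hGfi
  exact ⟨M.toSubgroup, inferInstance, M.isOpen', hMW,
    Subgroup.levelSeparable_of_isFreeGroup_finiteIndex D M.toSubgroup G (hfg M)⟩

end Engine

end Literature.AnabelianGeometry.SemiGraphs
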